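import Literature.Analysis.FluidPDE.SereginSverakBlowupDecayProofs
import Literature.Analysis.FluidPDE.SereginSverakScaledEnergyProofs
import Literature.Analysis.FluidPDE.SereginSverakMeridionalTypeI
import HarnessLib

/-!
# Seregin–Šverák 2009, proof of Lemma 3.5: the absorption estimate (as11) with the Type I rate
# on the meridional velocity only and the swirl bound (as7) as an input

G. Seregin, V. Šverák, *On Type I singularities of the local axi-symmetric solutions of the
Navier–Stokes equations*, Comm. PDE 34 (2009) 171–201 = arXiv:0804.1803 (labels and pages refer
to the arXiv version). In the proof of Lemma 3.5 (pp. 9–10) the cubic functional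
`C(z_b, r; v) = r⁻² ∫_{Q(z_b,r)} |v|³` is absorbed by `ε (E + A) + f₁` ((as11)) after splitting the
velocity into its azimuthal part `v̂ = v_φ e_φ`, controlled by the swirl bound
(as7) `|x'| |v_φ(x,t)| ≤ C₂` (Lemma 3.3), and its meridional part `v̄ = v_ϱ e_ϱ + v₃ e₃`,
controlled by the Type I rate — and this is the ONLY place where the rate enters the proof of
Theorems 1.1/3.1, and it enters through `v̄` alone ((as9): "To treat `v̄` which is the other part
of the velocity `v`, we chose numbers `s₂ = 4` and `l₂ = 12/7` … `M_{s₂,l₂}(z_b,r;v̄) ≤ c C^{12/7}`").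
This is why §1 of the paper states Theorem 1.1 with the rate (1.1)
`sup √(t₀ − t)|v̄(x,t)| < ∞` on the MERIDIONAL part only (the tree's named fact
`SereginSverak2009.MeridionalTypeIRegularity`, `SereginSverakMeridionalTypeI.lean`).

The tree's discharge of (as11) under the full-velocity rate (r3)
(`SereginSverak2009.CubicAbsorption_holds`, `SereginSverakScaledEnergyProofs.lean`) uses the
limiting case `(s, l) = (∞, 1)` of (as2) for the WHOLE field and therefore does not cover the
meridional hypothesis. This file PROVES (as11) in the printed two-part form, from

* (1.1) `√(-t) ‖ū(t,x)‖ ≤ C` a.e. on `Q` (`ū = poloidalPart (u t)`, the tree's name for `v̄`), and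
* (as7) `|Γ(t,x)| ≤ C₂` a.e. on `Q`, `Γ = swirl (u t) = x₀u₁ − x₁u₀ = |x'| u_φ` (the junk-free form
  of `|x'||v_φ| ≤ C₂`),

for a field `u` with a weak spatial gradient `G` on `Q = 𝒞 × ]-1, 0[` (Remark 3.4):

  `C(z_b, r; u) ≤ ε (E(z_b, 2r; G) + A(z_b, 2r; u)) + F(ε, C, C₂)`, `|b| ≤ 1/4`, `0 < r ≤ 3/8`

(`SereginSverak2009.cubicC_le_eps_meridional`). The two parts:

* (as8), the azimuthal part (`exists_lintegral_swirl_cube_le`): the tree's weighted interpolation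
  `SereginSverak2009.exists_cubicC_le_of_axisDecay` (`SereginSverakAxisWeightedCubic.lean`: weighted
  Hölder `|v̂|³ ≤ (C₂/|x'|)^{6/5} |v|^{9/5}`, the Sobolev inequality on the balls `B(b e₃, 2r) ⊇
  𝒞(b e₃, r)` slice-wise — whence the doubled radius — and Hölder in time) run for the MAJORANT
  `|v_φ| ≤ |v|` instead of `|v|`: `r⁻² ∫_{Q(z_b,r)} |v_φ|³ ≤ K₁ (C₂ + 1)^{6/5} (A + E)(z_b, 2r)^{9/10}`;
* (as9), the meridional part (`lintegral_cube_majorant_le_of_rate`): the short-window estimate of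
  the tree's `SereginSverak2009.lintegral_cube_le_of_typeI` run for the majorant `|v̄| ≤ |v|`:
  `r⁻² ∫_{Q(z_b,r)} |v̄|³ ≤ 2Kη A(z_b, r; v) + 8|B₁|K³η⁻³` for every `0 < η ≤ 1`
  (`|v̄|³ ≤ K(-t)^{-1/2}|v|²` on the window `-(ηr)² < t < 0`, `|v̄| ≤ K/(ηr)` before it);

and `|v|³ ≤ 4(|v̄|³ + |v_φ|³)` (`‖v‖ ≤ ‖v̄‖ + |v_φ|`), `A(z_b, r) ≤ 2 A(z_b, 2r)`, Young's inequality
(`mul_rpow_nine_tenths_le_eps`) and the choice of `η` give (as11) in exactly the doubled-radius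
shape consumed by the tree's contraction step `SereginSverak2009.decay_step_half36`
(`SereginSverakBlowupDecayProofs.lean`). The exponents differ from the printed (as8)–(as9)
(Sobolev `H¹ ⊂ L⁶` on balls in place of the special Gagliardo–Nirenberg inequality of [S10]);
the shape `C ≤ ε(E + A) + f₁(ε, C, C₂)` is the printed one. No named facts; nothing about blow-up.

## References

* G. Seregin, V. Šverák, Comm. PDE 34 (2009) 171–201, arXiv:0804.1803: §1 (1.1) p. 2, Thm 1.1
  p. 3; §3 Lemma 3.3 (as1), Lemma 3.5 and its proof (as2), (as5)–(as11) (pp. 9–10).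
  [`SereginSverak2009`]
* G. Seregin, W. Zajaczkowski, Zap. Nauchn. Sem. POMI 336 (2006) 46–54 (the paper's [S10], source
  of (as2)).
-/

noncomputable section

open MeasureTheory Set Function Filter Topology TopologicalSpace Metric Module
open scoped NNReal ENNReal InnerProductSpace RealInnerProductSpace

namespace Literature.Analysis.FluidPDE

namespace SereginSverak2009


/-! ### The decomposition `v = v̄ + v_φ e_φ`: pointwise algebra -/

/-- `u_φ = Γ/|x'|` everywhere (`u_φ = ⟪u, e_φ⟫`, `e_φ = |x'|⁻¹(−x₁, x₀, 0)`, `Γ = x₀u₁ − x₁u₀`; on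
the axis both sides vanish by the junk value `0⁻¹ = 0`). [cite: SereginSverak2009, §3 p. 9 (v̂ = v_φ e_φ)] -/
theorem swirlVelocity_eq_inv_cylRadius_mul_swirl (v : (EuclideanSpace ℝ (Fin 3)) → (EuclideanSpace ℝ (Fin 3))) (x : (EuclideanSpace ℝ (Fin 3))) :
    swirlVelocity v x = (cylRadius x)⁻¹ * swirl v x := by
  simp only [swirlVelocity, swirl, eTheta, inner_smul_right, PiLp.inner_apply, RCLike.inner_apply,
    conj_trivial, Fin.sum_univ_three, Matrix.cons_val_zero, Matrix.cons_val_one,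
    Matrix.cons_val_two, Matrix.head_cons, Matrix.tail_cons]
  ring

/-- The swirl bound (as7) in the junk-free form `|Γ| ≤ C₂` gives the weighted bound
`|x'| |u_φ| ≤ C₂` used in (as8). [cite: SereginSverak2009, proof of Lemma 3.5, (as7) (arXiv p. 9)] -/
theorem cylRadius_mul_abs_swirlVelocity_le {v : (EuclideanSpace ℝ (Fin 3)) → (EuclideanSpace ℝ (Fin 3))} {x : (EuclideanSpace ℝ (Fin 3))} {C : ℝ} (hC : 0 ≤ C)
    (h : |swirl v x| ≤ C) : cylRadius x * |swirlVelocity v x| ≤ C := by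
  by_cases hx : cylRadius x = 0
  · rw [hx, zero_mul]; exact hC
  · rw [swirl_eq_cylRadius_mul_swirlVelocity v hx, abs_mul, abs_of_nonneg (cylRadius_nonneg x)] at h
    exact h

/-- `‖v‖ ≤ ‖v̄‖ + |v_φ|` (`v = v̄ + v_φ e_φ`, `‖e_φ‖ ≤ 1`). [cite: SereginSverak2009, §3 p. 9 (v = v̄ + v̂)] -/
theorem norm_le_norm_poloidalPart_add_abs_swirlVelocity (v : (EuclideanSpace ℝ (Fin 3)) → (EuclideanSpace ℝ (Fin 3))) (x : (EuclideanSpace ℝ (Fin 3))) :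
    ‖v x‖ ≤ ‖poloidalPart v x‖ + |swirlVelocity v x| := by
  have h1 : v x = poloidalPart v x + swirlVelocity v x • eTheta x := by
    rw [poloidalPart_apply, sub_add_cancel]
  have hθ : ‖eTheta x‖ ≤ 1 := by
    have hn : ‖(WithLp.toLp 2 ![-x 1, x 0, (0 : ℝ)] : (EuclideanSpace ℝ (Fin 3)))‖ = cylRadius x := by
      rw [EuclideanSpace.norm_eq, cylRadius]
      congr 1
      simp [Fin.sum_univ_three]
      ring
    rw [eTheta, norm_smul, hn, norm_inv, Real.norm_eq_abs, abs_of_nonneg (cylRadius_nonneg x)]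
    by_cases hr : cylRadius x = 0
    · simp [hr]
    · rw [inv_mul_cancel₀ hr]
  calc ‖v x‖ = ‖poloidalPart v x + swirlVelocity v x • eTheta x‖ := by rw [← h1]
    _ ≤ ‖poloidalPart v x‖ + ‖swirlVelocity v x • eTheta x‖ := norm_add_le _ _
    _ = ‖poloidalPart v x‖ + |swirlVelocity v x| * ‖eTheta x‖ := by
        rw [norm_smul, Real.norm_eq_abs]
    _ ≤ ‖poloidalPart v x‖ + |swirlVelocity v x| * 1 := by gcongr
    _ = ‖poloidalPart v x‖ + |swirlVelocity v x| := by rw [mul_one]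

/-- `(a + b)³ ≤ 4(a³ + b³)` in `ℝ≥0∞`. [folklore] -/
private theorem add_pow_three_le_four_mul (a b : ℝ≥0∞) : (a + b) ^ (3 : ℕ) ≤ 4 * (a ^ (3 : ℕ) + b ^ (3 : ℕ)) := by
  rcases eq_or_ne a ⊤ with rfl | ha
  · simp
  rcases eq_or_ne b ⊤ with rfl | hb
  · simp
  lift a to ℝ≥0 using ha
  lift b to ℝ≥0 using hb
  have key : ((a : ℝ≥0) + b) ^ 3 ≤ 4 * (a ^ 3 + b ^ 3) := by
    have ha0 : (0 : ℝ) ≤ a := a.2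
    have hb0 : (0 : ℝ) ≤ b := b.2
    rw [← NNReal.coe_le_coe]
    push_cast
    nlinarith [sq_nonneg ((a : ℝ) - b), mul_nonneg ha0 hb0, sq_nonneg ((a : ℝ) + b)]
  exact_mod_cast key

/-- `‖v‖³ ≤ 4(‖v̄‖³ + |v_φ|³)` in `ℝ≥0∞`, the splitting of the cubic integrand used for (as10).
[cite: SereginSverak2009, proof of Lemma 3.5, (as8)–(as10) (arXiv pp. 9–10)] -/
theorem enorm_pow_three_le_poloidal_add_swirl (v : (EuclideanSpace ℝ (Fin 3)) → (EuclideanSpace ℝ (Fin 3))) (x : (EuclideanSpace ℝ (Fin 3))) :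
    ‖v x‖ₑ ^ (3 : ℕ) ≤ 4 * (ENNReal.ofReal ‖poloidalPart v x‖ ^ (3 : ℕ) +
      ‖swirlVelocity v x‖ₑ ^ (3 : ℕ)) := by
  have h1 : ‖v x‖ₑ ≤ ENNReal.ofReal ‖poloidalPart v x‖ + ‖swirlVelocity v x‖ₑ := by
    rw [← ofReal_norm, Real.enorm_eq_ofReal_abs, ← ENNReal.ofReal_add (norm_nonneg _) (abs_nonneg _)]
    exact ENNReal.ofReal_le_ofReal (norm_le_norm_poloidalPart_add_abs_swirlVelocity v x)
  exact (pow_le_pow_left' h1 3).trans (add_pow_three_le_four_mul _ _)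

/-- The swirl velocity of an a.e.-strongly measurable slice is a.e.-measurable (`u_φ = |x'|⁻¹ Γ`
with `Γ = x₀u₁ − x₁u₀`; needed to integrate the azimuthal part `v̂ = v_φ e_φ` of a weak solution).
[cite: SereginSverak2009, §3 p. 9 (v̂ = v_φ e_φ) and proof of Lemma 3.5, (as8)] -/
theorem aemeasurable_swirlVelocity {μ : Measure (EuclideanSpace ℝ (Fin 3))} {v : (EuclideanSpace ℝ (Fin 3)) → (EuclideanSpace ℝ (Fin 3))} (hv : AEStronglyMeasurable v μ) :
    AEMeasurable (fun x => swirlVelocity v x) μ := by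
  have heq : (fun x => swirlVelocity v x) = fun x => (cylRadius x)⁻¹ * (x 0 * v x 1 - x 1 * v x 0) := by
    funext x; rw [swirlVelocity_eq_inv_cylRadius_mul_swirl]; rfl
  rw [heq]
  have h0 : AEMeasurable (fun x => v x 0) μ :=
    ((EuclideanSpace.proj (0 : Fin 3)).continuous.comp_aestronglyMeasurable hv).aemeasurable
  have h1 : AEMeasurable (fun x => v x 1) μ :=
    ((EuclideanSpace.proj (1 : Fin 3)).continuous.comp_aestronglyMeasurable hv).aemeasurable
  have hc0 : Measurable fun x : (EuclideanSpace ℝ (Fin 3)) => x 0 := (EuclideanSpace.proj (0 : Fin 3)).continuous.measurable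
  have hc1 : Measurable fun x : (EuclideanSpace ℝ (Fin 3)) => x 1 := (EuclideanSpace.proj (1 : Fin 3)).continuous.measurable
  exact (continuous_cylRadius.measurable.inv.aemeasurable).mul
    ((hc0.aemeasurable.mul h1).sub (hc1.aemeasurable.mul h0))

/-! ### A weighted Hölder inequality for a majorant -/

/-- **The weighted Hölder step of (as8) for a majorised integrand.** On any measure space, if
`g ≤ f` and `w g ≤ K` a.e. for a weight `w` and `0 < K < ∞`, then
`∫ g³ ≤ K^{6/5} (∫ w^{-12/7})^{7/10} (∫ f⁶)^{3/10}`: write `g³ = g^{6/5} g^{9/5} ≤ (K/w)^{6/5} f^{9/5}`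
and apply Hölder's inequality with exponents `10/7` and `10/3` (the tree's
`lintegral_cube_le_weighted` is the case `g = f`). [cite: SereginSverak2009, proof of Lemma 3.5, (as2) and (as8) (arXiv p. 9)] -/
theorem lintegral_cube_le_weighted_of_le {α : Type*} [MeasurableSpace α] (μ : Measure α)
    {f g w : α → ℝ≥0∞} (hf : AEMeasurable f μ) (hw : AEMeasurable w μ)
    {K : ℝ≥0∞} (hK : K ≠ 0) (hKt : K ≠ ∞) (hgf : ∀ᵐ x ∂μ, g x ≤ f x)
    (hgw : ∀ᵐ x ∂μ, w x * g x ≤ K) :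
    ∫⁻ x, g x ^ (3 : ℕ) ∂μ ≤ K ^ (6 / 5 : ℝ) * (∫⁻ x, (w x)⁻¹ ^ (12 / 7 : ℝ) ∂μ) ^ (7 / 10 : ℝ) *
      (∫⁻ x, f x ^ (6 : ℝ) ∂μ) ^ (3 / 10 : ℝ) := by
  -- pointwise: `g ≤ K w⁻¹`, hence `g³ = g^{6/5} g^{9/5} ≤ K^{6/5} (w⁻¹)^{6/5} f^{9/5}`
  have hpt : ∀ᵐ x ∂μ, g x ^ (3 : ℕ) ≤
      K ^ (6 / 5 : ℝ) * ((w x)⁻¹ ^ (6 / 5 : ℝ) * f x ^ (9 / 5 : ℝ)) := by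
    filter_upwards [hgw, hgf] with x hx hxf
    have h1 : g x ≤ K / w x := by
      rw [ENNReal.le_div_iff_mul_le (Or.inr hK) (Or.inr hKt), mul_comm]
      exact hx
    have h2 : g x ^ (6 / 5 : ℝ) ≤ K ^ (6 / 5 : ℝ) * (w x)⁻¹ ^ (6 / 5 : ℝ) := by
      rw [← ENNReal.mul_rpow_of_nonneg _ _ (by norm_num), ← div_eq_mul_inv]
      exact ENNReal.rpow_le_rpow h1 (by norm_num)
    have h2' : g x ^ (9 / 5 : ℝ) ≤ f x ^ (9 / 5 : ℝ) := ENNReal.rpow_le_rpow hxf (by norm_num)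
    have h3 : g x ^ (3 : ℕ) = g x ^ (6 / 5 : ℝ) * g x ^ (9 / 5 : ℝ) := by
      rw [← ENNReal.rpow_add_of_nonneg _ _ (by norm_num) (by norm_num), ← ENNReal.rpow_natCast]
      norm_num
    rw [h3, ← mul_assoc]
    exact mul_le_mul' h2 h2'
  -- Hölder with exponents `10/7` and `10/3`
  have hpq : (10 / 7 : ℝ).HolderConjugate (10 / 3) :=
    Real.holderConjugate_iff.2 ⟨by norm_num, by norm_num⟩
  have hH := ENNReal.lintegral_mul_le_Lp_mul_Lq μ hpq
    (f := fun x => (w x)⁻¹ ^ (6 / 5 : ℝ)) (g := fun x => f x ^ (9 / 5 : ℝ))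
    ((hw.inv).pow_const _) (hf.pow_const _)
  have e1 : ∀ x, ((w x)⁻¹ ^ (6 / 5 : ℝ)) ^ (10 / 7 : ℝ) = (w x)⁻¹ ^ (12 / 7 : ℝ) := fun x => by
    rw [← ENNReal.rpow_mul]; norm_num
  have e2 : ∀ x, (f x ^ (9 / 5 : ℝ)) ^ (10 / 3 : ℝ) = f x ^ (6 : ℝ) := fun x => by
    rw [← ENNReal.rpow_mul]; norm_num
  simp only [Pi.mul_apply, e1, e2] at hH
  rw [show (1 : ℝ) / (10 / 7) = 7 / 10 by norm_num, show (1 : ℝ) / (10 / 3) = 3 / 10 by norm_num]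
    at hH
  calc ∫⁻ x, g x ^ (3 : ℕ) ∂μ
      ≤ ∫⁻ x, K ^ (6 / 5 : ℝ) * ((w x)⁻¹ ^ (6 / 5 : ℝ) * f x ^ (9 / 5 : ℝ)) ∂μ := lintegral_mono_ae hpt
    _ = K ^ (6 / 5 : ℝ) * ∫⁻ x, (w x)⁻¹ ^ (6 / 5 : ℝ) * f x ^ (9 / 5 : ℝ) ∂μ :=
        lintegral_const_mul' _ _ (ENNReal.rpow_ne_top_of_nonneg (by norm_num) hKt)
    _ ≤ K ^ (6 / 5 : ℝ) * ((∫⁻ x, (w x)⁻¹ ^ (12 / 7 : ℝ) ∂μ) ^ (7 / 10 : ℝ) *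
          (∫⁻ x, f x ^ (6 : ℝ) ∂μ) ^ (3 / 10 : ℝ)) := by gcongr
    _ = _ := by ring


/-- `|v_φ| ≤ ‖v‖` (`‖e_φ‖ ≤ 1`, junk value `0` on the axis). [cite: SereginSverak2009, §3 p. 9 (v = v̄ + v̂, |v̂| ≤ |v|)] -/
theorem abs_swirlVelocity_le_norm (v : (EuclideanSpace ℝ (Fin 3)) → (EuclideanSpace ℝ (Fin 3))) (x : (EuclideanSpace ℝ (Fin 3))) : |swirlVelocity v x| ≤ ‖v x‖ := by
  have hθ : ‖eTheta x‖ ≤ 1 := by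
    have hn : ‖(WithLp.toLp 2 ![-x 1, x 0, (0 : ℝ)] : (EuclideanSpace ℝ (Fin 3)))‖ = cylRadius x := by
      rw [EuclideanSpace.norm_eq, cylRadius]
      congr 1
      simp [Fin.sum_univ_three]
      ring
    rw [eTheta, norm_smul, hn, norm_inv, Real.norm_eq_abs, abs_of_nonneg (cylRadius_nonneg x)]
    by_cases hr : cylRadius x = 0
    · simp [hr]
    · rw [inv_mul_cancel₀ hr]
  calc |swirlVelocity v x| = |⟪v x, eTheta x⟫| := rfl
    _ ≤ ‖v x‖ * ‖eTheta x‖ := abs_real_inner_le_norm _ _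
    _ ≤ ‖v x‖ * 1 := by gcongr
    _ = ‖v x‖ := mul_one _

/-! ### (as8): the azimuthal part of the cubic functional under the swirl bound -/

/-- **Seregin–Šverák 2009, proof of Lemma 3.5, (as8): the azimuthal part `v̂ = v_φ e_φ` of the
cubic functional under the swirl bound (as7).** There is an absolute `K₁` such that for every field
`u` with a weak spatial gradient `G` on `Q = 𝒞 × ]-1, 0[` (Remark 3.4) and `|Γ(t, x)| ≤ C` a.e. on `Q`
(`Γ = swirl (u t) = |x'| u_φ`, the junk-free form of (as7) `|x'||v_φ| ≤ C₂`), all `|b| ≤ 1/4` and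
`0 < r ≤ 3/8`:
`r⁻² ∫_{Q(z_b, r)} |u_φ|³ ≤ K₁ (C + 1)^{6/5} (A(z_b, 2r; u) + E(z_b, 2r; G))^{9/10}`, `z_b = (0, b e₃)`.
Printed: `C(z_b,r;v̂-part) ≤ c A^{1/58} (C₂^{10})^{7/58} (E + A)^{51/58}` from (as2) with
`(s₁, l₁) = (7/4, 10)`; here, as in the tree's `exists_cubicC_le_of_axisDecay` (the same estimate for
a field with `|x'||v| ≤ C`), the weighted Hölder inequality `|v_φ|³ ≤ (C/|x'|)^{6/5} |v|^{9/5}`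
(`|v_φ| ≤ |v|`), the Sobolev inequality `H¹ ⊂ L⁶` on the balls `B(b e₃, 2r) ⊇ 𝒞(b e₃, r)` slice-wise
and Hölder in time — whence the exponents `6/5`, `9/10` and the doubled radius.
[cite: SereginSverak2009, proof of Lemma 3.5, (as7)–(as8) (arXiv p. 9)] -/
theorem exists_lintegral_swirl_cube_le :
    ∃ K₁ : ℝ≥0, ∀ (u : ℝ → (EuclideanSpace ℝ (Fin 3)) → (EuclideanSpace ℝ (Fin 3))) (G : ℝ → (EuclideanSpace ℝ (Fin 3)) → (EuclideanSpace ℝ (Fin 3)) →L[ℝ] (EuclideanSpace ℝ (Fin 3))) (C : ℝ≥0) (b r : ℝ),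
      HasWeakSpatialGradientOn (parCylOpens 0 1) u G →
      (∀ᵐ z ∂(volume.restrict (parCyl 0 1)), |swirl (u z.1) z.2| ≤ C) →
      |b| ≤ 1 / 4 → 0 < r → r ≤ 3 / 8 →
      (ENNReal.ofReal r ^ 2)⁻¹ * (∫⁻ q in parCyl ((0 : ℝ), b • eZ) r,
          ‖swirlVelocity (u q.1) q.2‖ₑ ^ (3 : ℕ)) ≤
        K₁ * ((C : ℝ≥0∞) + 1) ^ (6 / 5 : ℝ) *
          (energyA ((0 : ℝ), b • eZ) (2 * r) u + dissipationE ((0 : ℝ), b • eZ) (2 * r) G) ^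
            (9 / 10 : ℝ) := by
  obtain ⟨CS, hCS⟩ := exists_sobolev_slice_bound
  set V₁ : ℝ≥0∞ := ∫⁻ w in ball (0 : (EuclideanSpace ℝ (Fin 2))) 1, (ENNReal.ofReal ‖w‖)⁻¹ ^ (12 / 7 : ℝ) with hV₁
  have hV₁t : V₁ ≠ ∞ := lintegral_inv_norm_rpow_unitBall_lt_top.ne
  -- the constant
  set K₀ : ℝ≥0∞ := (2 * V₁) ^ (7 / 10 : ℝ) * (2 : ℝ≥0∞) ^ (9 / 5 : ℝ) * CS with hK₀
  have hK₀t : K₀ ≠ ∞ := by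
    refine ENNReal.mul_ne_top (ENNReal.mul_ne_top ?_ ?_) ENNReal.coe_ne_top
    · exact ENNReal.rpow_ne_top_of_nonneg (by norm_num) (ENNReal.mul_ne_top (by simp) hV₁t)
    · exact ENNReal.rpow_ne_top_of_nonneg (by norm_num) (by simp)
  refine ⟨K₀.toNNReal + 1, fun u G C b r hG hr7 hb hr hr38 => ?_⟩
  have hK₁ : ((K₀.toNNReal + 1 : ℝ≥0) : ℝ≥0∞) = K₀ + 1 := by
    push_cast; rw [ENNReal.coe_toNNReal hK₀t]
  rw [hK₁]
  -- notation
  set z : ℝ × (EuclideanSpace ℝ (Fin 3)) := ((0 : ℝ), b • eZ) with hz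
  set ρ : ℝ := 2 * r with hρ
  have hρ0 : 0 < ρ := by positivity
  have hρ0' : ENNReal.ofReal ρ ≠ 0 := (ENNReal.ofReal_pos.2 hρ0).ne'
  set A := energyA z ρ u with hA
  set E := dissipationE z ρ G with hE
  set K : ℝ≥0∞ := (C : ℝ≥0∞) + 1 with hK
  have hK0 : K ≠ 0 := by simp [hK]
  have hKt : K ≠ ∞ := by simp [hK]
  -- the integrand
  set g : ℝ → (EuclideanSpace ℝ (Fin 3)) → ℝ≥0∞ := fun t x => ‖swirlVelocity (u t) x‖ₑ with hg
  -- trivial when `A + E = ∞`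
  rcases eq_or_ne (A + E) ∞ with hAE | hAE
  · rw [hAE, ENNReal.top_rpow_of_pos (by norm_num), ENNReal.mul_top]
    · exact le_top
    · exact mul_ne_zero (by simp) (ENNReal.rpow_pos (pos_iff_ne_zero.2 hK0) hKt).ne'
  have hAt : A ≠ ∞ := ne_top_of_le_ne_top hAE le_self_add
  have hEt : E ≠ ∞ := ne_top_of_le_ne_top hAE le_add_self
  -- sets
  set I : Set ℝ := Ioo (-r ^ 2) 0 with hI
  set S : Set (EuclideanSpace ℝ (Fin 3)) := spaceCyl (b • eZ) r with hS
  set B : Set (EuclideanSpace ℝ (Fin 3)) := ball (b • eZ) ρ with hB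
  have hzI : Ioo (z.1 - r ^ 2) z.1 = I := by
    show Ioo ((0 : ℝ) - r ^ 2) 0 = I
    rw [zero_sub]
  have hQ : parCyl z r = I ×ˢ S := by rw [parCyl_eq_prod, hzI]
  have hSB : S ⊆ B := by rw [hS, hB, hρ]; exact spaceCyl_subset_ball _ _
  have hBS : B ⊆ spaceCyl (b • eZ) ρ := fun x hx => mem_spaceCyl_of_norm_lt (mem_ball_iff_norm.1 hx)
  have hIρ : I ⊆ Ioo (z.1 - ρ ^ 2) z.1 := by
    intro t ht
    show t ∈ Ioo ((0 : ℝ) - ρ ^ 2) 0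
    refine ⟨?_, ht.2⟩
    have := ht.1
    rw [hρ]
    nlinarith [hr]
  have hIB : I ×ˢ B ⊆ parCyl z ρ := by
    rw [parCyl_eq_prod]; exact prod_mono hIρ hBS
  have hQρ : parCyl z ρ ⊆ parCyl 0 1 :=
    parCyl_axis_subset hρ0.le (by rw [hρ]; linarith [abs_nonneg b])
  have hIB1 : I ×ˢ B ⊆ parCyl 0 1 := hIB.trans hQρ
  -- measurability
  have hum : AEStronglyMeasurable (uncurry u) (volume.restrict (I ×ˢ B)) :=
    (hG.locallyIntegrableOn.mono_set hIB1).aestronglyMeasurable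
  have hGm : AEStronglyMeasurable (uncurry G) (volume.restrict (I ×ˢ B)) :=
    (hG.locallyIntegrableOn_grad.mono_set hIB1).aestronglyMeasurable
  have hprod : (volume.restrict (I ×ˢ B) : Measure (ℝ × (EuclideanSpace ℝ (Fin 3)))) =
      (volume.restrict I).prod (volume.restrict B) := by
    rw [Measure.volume_eq_prod, Measure.prod_restrict]
  set a : ℝ → ℝ≥0∞ := fun t => ∫⁻ x in B, ‖u t x‖ₑ ^ 2 with ha
  set e : ℝ → ℝ≥0∞ := fun t => ∫⁻ x in B, ENNReal.ofReal (frobeniusNormSq (G t x)) with he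
  have hum2 : AEMeasurable (fun q : ℝ × (EuclideanSpace ℝ (Fin 3)) => ‖u q.1 q.2‖ₑ ^ 2)
      ((volume.restrict I).prod (volume.restrict B)) := by
    rw [← hprod]; exact hum.enorm.pow_const 2
  have hGm2 : AEMeasurable (fun q : ℝ × (EuclideanSpace ℝ (Fin 3)) => ENNReal.ofReal (frobeniusNormSq (G q.1 q.2)))
      ((volume.restrict I).prod (volume.restrict B)) := by
    rw [← hprod]
    exact (SereginZajaczkowski2007.continuous_frobeniusNormSq.comp_aestronglyMeasurable
      hGm).aemeasurable.ennreal_ofReal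
  have ham : AEMeasurable a (volume.restrict I) := hum2.lintegral_prod_right'
  have hem : AEMeasurable e (volume.restrict I) := hGm2.lintegral_prod_right'
  -- (i) `∫_I e = ∫∫_{I × B} |G|² ≤ ρ E`
  have hIe : ∫⁻ t in I, e t ≤ ENNReal.ofReal ρ * E := by
    calc ∫⁻ t in I, e t = ∫⁻ q in I ×ˢ B, ENNReal.ofReal (frobeniusNormSq (G q.1 q.2)) := by
          rw [hprod, lintegral_prod _ hGm2]
      _ ≤ ∫⁻ q in parCyl z ρ, ENNReal.ofReal (frobeniusNormSq (G q.1 q.2)) :=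
          lintegral_mono_set hIB
      _ = ENNReal.ofReal ρ * E := setLIntegral_eq_mul_dissipationE z hρ0 G
  -- (ii) a.e. in `t ∈ I`: energy bound, finiteness of `e`, weak derivative of the slice, (as7)
  have h1 : ∀ᵐ t ∂(volume.restrict I), a t ≤ ENNReal.ofReal ρ * A := by
    have h := ae_restrict_of_ae_restrict_of_subset hIρ (ae_lintegral_sq_le_energyA z hρ0 u)
    filter_upwards [h] with t ht
    exact (lintegral_mono_set hBS).trans ht
  have h2 : ∀ᵐ t ∂(volume.restrict I), e t < ∞ := by
    refine ae_lt_top' hem (ne_top_of_le_ne_top ?_ hIe)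
    exact ENNReal.mul_ne_top ENNReal.ofReal_ne_top hEt
  have h3 : ∀ᵐ t ∂(volume.restrict I), FunctionSpaces.HasWeakFDerivOn
      (⟨B, isOpen_ball⟩ : Opens (EuclideanSpace ℝ (Fin 3))) volume (u t) (G t) := by
    have hG' : HasWeakSpatialGradientOn
        (⟨Ioo (-r ^ 2) 0 ×ˢ ((⟨B, isOpen_ball⟩ : Opens (EuclideanSpace ℝ (Fin 3))) : Set (EuclideanSpace ℝ (Fin 3))),
          isOpen_Ioo.prod isOpen_ball⟩ : Opens (ℝ × (EuclideanSpace ℝ (Fin 3)))) u G :=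
      hG.mono (fun q hq => hIB1 hq)
    exact hG'.ae_hasWeakFDerivOn_slice
  have h4 : ∀ᵐ t ∂(volume.restrict I), ∀ᵐ x ∂(volume.restrict B),
      |swirl (u t) x| ≤ C := by
    have h := ae_restrict_of_ae_restrict_of_subset hIB1 hr7
    exact ae_ae_of_ae_restrict_prod (P := fun q : ℝ × (EuclideanSpace ℝ (Fin 3)) => |swirl (u q.1) q.2| ≤ C) h
  -- the weight on `B`
  set W : ℝ≥0∞ := ∫⁻ x in B, (ENNReal.ofReal (cylRadius x))⁻¹ ^ (12 / 7 : ℝ) with hW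
  have hWle : W ≤ 2 * V₁ * ENNReal.ofReal ρ ^ (9 / 7 : ℝ) := by
    calc W ≤ ∫⁻ x in spaceCyl (b • eZ) ρ, (ENNReal.ofReal (cylRadius x))⁻¹ ^ (12 / 7 : ℝ) :=
          lintegral_mono_set hBS
      _ = ENNReal.ofReal (2 * ρ) * (ENNReal.ofReal ρ ^ (2 / 7 : ℝ) * V₁) :=
          lintegral_inv_cylRadius_rpow_spaceCyl b hρ0
      _ = 2 * V₁ * ENNReal.ofReal ρ ^ (9 / 7 : ℝ) := by
          rw [ENNReal.ofReal_mul zero_le_two, ENNReal.ofReal_ofNat,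
            show (9 / 7 : ℝ) = 1 + 2 / 7 by norm_num,
            ENNReal.rpow_add _ _ hρ0' ENNReal.ofReal_ne_top, ENNReal.rpow_one]
          ring
  have hWt : W ≠ ∞ := ne_top_of_le_ne_top (ENNReal.mul_ne_top (ENNReal.mul_ne_top (by simp) hV₁t)
    (ENNReal.rpow_ne_top_of_nonneg (by norm_num) ENNReal.ofReal_ne_top)) hWle
  -- (iii) the slice estimate
  set M : ℝ≥0∞ := K ^ (6 / 5 : ℝ) * W ^ (7 / 10 : ℝ) * CS with hM
  have hMt : M ≠ ∞ := ENNReal.mul_ne_top (ENNReal.mul_ne_top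
    (ENNReal.rpow_ne_top_of_nonneg (by norm_num) hKt)
    (ENNReal.rpow_ne_top_of_nonneg (by norm_num) hWt)) ENNReal.coe_ne_top
  set X : ℝ → ℝ≥0∞ := fun t => (ENNReal.ofReal ρ)⁻¹ ^ 2 * a t + e t with hX
  have hXm : AEMeasurable X (volume.restrict I) := (ham.const_mul _).add hem
  have hslice : ∀ᵐ t ∂(volume.restrict I),
      ∫⁻ x in S, g t x ^ (3 : ℕ) ≤ M * X t ^ (9 / 10 : ℝ) := by
    filter_upwards [h1, h2, h3, h4] with t hat het hwt hr7t
    have hutm : AEStronglyMeasurable (u t) (volume.restrict B) :=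
      hwt.locallyIntegrableOn.aestronglyMeasurable
    have hat' : a t ≠ ∞ := ne_top_of_le_ne_top (ENNReal.mul_ne_top ENNReal.ofReal_ne_top hAt) hat
    -- the weighted bound on `B`
    have hfw : ∀ᵐ x ∂(volume.restrict B), ENNReal.ofReal (cylRadius x) * g t x ≤ K := by
      filter_upwards [hr7t] with x hx
      have hC0 : (0 : ℝ) ≤ C := C.2
      have hwx := cylRadius_mul_abs_swirlVelocity_le hC0 hx
      rw [hg]
      dsimp only
      rw [Real.enorm_eq_ofReal_abs, ← ENNReal.ofReal_mul (cylRadius_nonneg _)]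
      calc ENNReal.ofReal (cylRadius x * |swirlVelocity (u t) x|) ≤ ENNReal.ofReal C :=
            ENNReal.ofReal_le_ofReal hwx
        _ = (C : ℝ≥0∞) := ENNReal.ofReal_coe_nnreal
        _ ≤ K := le_self_add
    have hgf : ∀ᵐ x ∂(volume.restrict B), g t x ≤ ‖u t x‖ₑ := by
      refine Eventually.of_forall fun x => ?_
      rw [hg]
      dsimp only
      rw [Real.enorm_eq_ofReal_abs, ← ofReal_norm]
      exact ENNReal.ofReal_le_ofReal (abs_swirlVelocity_le_norm (u t) x)
    have hwH := lintegral_cube_le_weighted_of_le (volume.restrict B) (f := fun x => ‖u t x‖ₑ)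
      (g := g t) (w := fun x => ENNReal.ofReal (cylRadius x)) hutm.enorm
      continuous_cylRadius.measurable.ennreal_ofReal.aemeasurable hK0 hKt hgf hfw
    have hSob := hCS (b • eZ) ρ hρ0 (u t) (G t) hwt hat' het.ne
    calc ∫⁻ x in S, g t x ^ (3 : ℕ) ≤ ∫⁻ x in B, g t x ^ (3 : ℕ) := lintegral_mono_set hSB
      _ ≤ K ^ (6 / 5 : ℝ) * W ^ (7 / 10 : ℝ) * (∫⁻ x in B, ‖u t x‖ₑ ^ (6 : ℝ)) ^ (3 / 10 : ℝ) := hwH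
      _ ≤ K ^ (6 / 5 : ℝ) * W ^ (7 / 10 : ℝ) * (CS * X t ^ (9 / 10 : ℝ)) := by gcongr
      _ = M * X t ^ (9 / 10 : ℝ) := by rw [hM]; ring
  -- (iv) integrate in time
  have hvolI : (volume.restrict I) univ = ENNReal.ofReal (r ^ 2) := by
    rw [Measure.restrict_apply_univ, hI, Real.volume_Ioo]; congr 1; ring
  have hIX : ∫⁻ t in I, X t ≤ ENNReal.ofReal ρ * (A + E) := by
    have hIa : ∫⁻ t in I, a t ≤ ENNReal.ofReal (r ^ 2) * ENNReal.ofReal ρ * A := by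
      calc ∫⁻ t in I, a t ≤ ∫⁻ _ in I, ENNReal.ofReal ρ * A := lintegral_mono_ae h1
        _ = ENNReal.ofReal ρ * A * (volume.restrict I) univ := lintegral_const _
        _ = ENNReal.ofReal (r ^ 2) * ENNReal.ofReal ρ * A := by rw [hvolI]; ring
    have hct : (ENNReal.ofReal ρ)⁻¹ ^ 2 ≠ ∞ := ENNReal.pow_ne_top (ENNReal.inv_ne_top.2 hρ0')
    calc ∫⁻ t in I, X t = (ENNReal.ofReal ρ)⁻¹ ^ 2 * (∫⁻ t in I, a t) + ∫⁻ t in I, e t := by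
          rw [hX, lintegral_add_left' (ham.const_mul _), lintegral_const_mul' _ _ hct]
      _ ≤ (ENNReal.ofReal ρ)⁻¹ ^ 2 * (ENNReal.ofReal (r ^ 2) * ENNReal.ofReal ρ * A) +
            ENNReal.ofReal ρ * E := add_le_add (mul_le_mul_right hIa _) hIe
      _ = (ENNReal.ofReal ρ)⁻¹ ^ 2 * (ENNReal.ofReal (r ^ 2) * ENNReal.ofReal ρ) * A +
            ENNReal.ofReal ρ * E := by ring
      _ ≤ ENNReal.ofReal ρ * A + ENNReal.ofReal ρ * E := by
          gcongr
          rw [hρ]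
          exact inv_sq_mul_le hr
      _ = ENNReal.ofReal ρ * (A + E) := by ring
  have htime : ∫⁻ t in I, ∫⁻ x in S, g t x ^ (3 : ℕ) ≤
      M * (ENNReal.ofReal (r ^ 2) ^ (1 / 10 : ℝ) * (ENNReal.ofReal ρ * (A + E)) ^ (9 / 10 : ℝ)) := by
    calc ∫⁻ t in I, ∫⁻ x in S, g t x ^ (3 : ℕ)
        ≤ ∫⁻ t in I, M * X t ^ (9 / 10 : ℝ) := lintegral_mono_ae hslice
      _ = M * ∫⁻ t in I, X t ^ (9 / 10 : ℝ) := lintegral_const_mul' _ _ hMt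
      _ ≤ M * ((volume.restrict I) univ ^ (1 / 10 : ℝ) * (∫⁻ t in I, X t) ^ (9 / 10 : ℝ)) := by
          gcongr
          exact lintegral_rpow_nine_tenths_le _ hXm
      _ ≤ M * (ENNReal.ofReal (r ^ 2) ^ (1 / 10 : ℝ) * (ENNReal.ofReal ρ * (A + E)) ^ (9 / 10 : ℝ)) := by
          rw [hvolI]
          gcongr
  -- (v) Tonelli and the cancellation of the powers of `r`
  set R : ℝ≥0∞ := ENNReal.ofReal r with hR
  have hR0 : R ≠ 0 := (ENNReal.ofReal_pos.2 hr).ne'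
  have hRt : R ≠ ∞ := ENNReal.ofReal_ne_top
  have hρR : ENNReal.ofReal ρ = 2 * R := by
    rw [hρ, ENNReal.ofReal_mul zero_le_two, ENNReal.ofReal_ofNat]
  have hr2R : ENNReal.ofReal (r ^ 2) = R ^ 2 := by rw [hR, ENNReal.ofReal_pow hr.le]
  have hmain : ∫⁻ q in parCyl z r, g q.1 q.2 ^ (3 : ℕ) ≤
      K₀ * K ^ (6 / 5 : ℝ) * R ^ 2 * (A + E) ^ (9 / 10 : ℝ) := by
    calc ∫⁻ q in parCyl z r, g q.1 q.2 ^ (3 : ℕ)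
        = ∫⁻ q in I ×ˢ S, g q.1 q.2 ^ (3 : ℕ) := by rw [hQ]
      _ ≤ ∫⁻ t in I, ∫⁻ x in S, g t x ^ (3 : ℕ) := by
          rw [Measure.volume_eq_prod, ← Measure.prod_restrict]
          exact lintegral_prod_le _
      _ ≤ M * (ENNReal.ofReal (r ^ 2) ^ (1 / 10 : ℝ) * (ENNReal.ofReal ρ * (A + E)) ^ (9 / 10 : ℝ)) :=
          htime
      _ ≤ (K ^ (6 / 5 : ℝ) * (2 * V₁ * ENNReal.ofReal ρ ^ (9 / 7 : ℝ)) ^ (7 / 10 : ℝ) * CS) *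
            (ENNReal.ofReal (r ^ 2) ^ (1 / 10 : ℝ) *
              (ENNReal.ofReal ρ ^ (9 / 10 : ℝ) * (A + E) ^ (9 / 10 : ℝ))) := by
          rw [← ENNReal.mul_rpow_of_nonneg _ _ (by norm_num : (0 : ℝ) ≤ 9 / 10)]
          have hMle : M ≤ K ^ (6 / 5 : ℝ) * (2 * V₁ * ENNReal.ofReal ρ ^ (9 / 7 : ℝ)) ^ (7 / 10 : ℝ) * CS := by
            rw [hM]; gcongr
          exact mul_le_mul_left hMle _
      _ = (K ^ (6 / 5 : ℝ) * (2 * V₁ * (2 * R) ^ (9 / 7 : ℝ)) ^ (7 / 10 : ℝ) * CS *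
            (R ^ 2) ^ (1 / 10 : ℝ) * (2 * R) ^ (9 / 10 : ℝ)) * (A + E) ^ (9 / 10 : ℝ) := by
          rw [hρR, hr2R]; ring
      _ = K₀ * K ^ (6 / 5 : ℝ) * R ^ 2 * (A + E) ^ (9 / 10 : ℝ) := by
          rw [radius_powers_identity hR0 hRt V₁ CS (K ^ (6 / 5 : ℝ)), hK₀]
  -- conclusion
  have hR2 : R ^ 2 ≠ 0 := pow_ne_zero _ hR0
  have hR2t : R ^ 2 ≠ ∞ := ENNReal.pow_ne_top hRt
  calc (R ^ 2)⁻¹ * ∫⁻ q in parCyl z r, g q.1 q.2 ^ (3 : ℕ)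
      ≤ (R ^ 2)⁻¹ * (K₀ * K ^ (6 / 5 : ℝ) * R ^ 2 * (A + E) ^ (9 / 10 : ℝ)) := by gcongr
    _ = K₀ * K ^ (6 / 5 : ℝ) * (A + E) ^ (9 / 10 : ℝ) := by
        calc (R ^ 2)⁻¹ * (K₀ * K ^ (6 / 5 : ℝ) * R ^ 2 * (A + E) ^ (9 / 10 : ℝ))
            = ((R ^ 2)⁻¹ * R ^ 2) * (K₀ * K ^ (6 / 5 : ℝ) * (A + E) ^ (9 / 10 : ℝ)) := by ring
          _ = _ := by rw [ENNReal.inv_mul_cancel hR2 hR2t, one_mul]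
    _ ≤ (K₀ + 1) * K ^ (6 / 5 : ℝ) * (A + E) ^ (9 / 10 : ℝ) := by
        gcongr
        exact le_self_add

/-! ### (as9): the meridional part of the cubic functional under the Type I rate -/

/-- **Seregin–Šverák 2009, proof of Lemma 3.5, (as9): the meridional part under the rate, short-window
form, for a majorant.** If `m ≥ 0` is dominated by `‖u‖` pointwise and obeys the Type I rate
`√(-t) m ≤ K` a.e. on `Q((0, x₀), r)` (`K ≥ 0`, `r > 0`), and `u` is a.e. strongly measurable there,
then for every `0 < η ≤ 1`
`∫_{Q((0,x₀), r)} m³ ≤ 2Kη · r² A((0, x₀), r; u) + (8K³/η³) · r² |B₁|`: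
on the window `-(ηr)² < t < 0`, `m³ ≤ K(-t)^{-1/2} |u|²`, the slices carry `∫_{𝒞(x₀, r)} |u(t)|² ≤ r A`
for a.e. `t`, and `∫_{-(ηr)²}^{0} K(-t)^{-1/2} dt = 2Kηr`; before the window `m ≤ K/(ηr)` and
`|Q((0, x₀), r)| ≤ r² (2r)³ |B₁|`. The tree's `lintegral_cube_le_of_typeI` is the case `m = ‖u‖`
((r3) on the whole field); the printed (as9) treats `m = |v̄|` through (as2) with
`(s₂, l₂) = (4, 12/7)` — the short window replaces the Gagliardo–Nirenberg step, the output shape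
`C(v̄-part) ≤ (small) · A + f` is the one used in (as10)–(as11).
[cite: SereginSverak2009, proof of Lemma 3.5, (as9)–(as11) (arXiv pp. 9–10)] -/
theorem lintegral_cube_majorant_le_of_rate {u : ℝ → (EuclideanSpace ℝ (Fin 3)) → (EuclideanSpace ℝ (Fin 3))} {x₀ : (EuclideanSpace ℝ (Fin 3))} {r : ℝ} (hr : 0 < r)
    {K : ℝ} (hK : 0 ≤ K)
    (hu : AEStronglyMeasurable (uncurry u) (volume.restrict (parCyl ((0 : ℝ), x₀) r)))
    {m : ℝ × (EuclideanSpace ℝ (Fin 3)) → ℝ} (hm0 : ∀ z, 0 ≤ m z) (hmu : ∀ z, m z ≤ ‖u z.1 z.2‖)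
    (hI : ∀ᵐ z ∂(volume.restrict (parCyl ((0 : ℝ), x₀) r)), Real.sqrt (-z.1) * m z ≤ K)
    {η : ℝ} (hη : 0 < η) (hη1 : η ≤ 1) :
    ∫⁻ z in parCyl ((0 : ℝ), x₀) r, ENNReal.ofReal (m z) ^ (3 : ℕ) ≤
      ENNReal.ofReal (2 * K * η) * ENNReal.ofReal r ^ 2 * energyA ((0 : ℝ), x₀) r u +
        ENNReal.ofReal (8 * K ^ 3 / η ^ 3) * ENNReal.ofReal r ^ 2 *
          volume (ball (0 : (EuclideanSpace ℝ (Fin 3))) 1) := by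
  -- notation
  set Q : Set (ℝ × (EuclideanSpace ℝ (Fin 3))) := parCyl ((0 : ℝ), x₀) r with hQ
  set I : Set ℝ := Ioo ((0 : ℝ) - r ^ 2) 0 with hIdef
  set S : Set (EuclideanSpace ℝ (Fin 3)) := spaceCyl x₀ r with hS
  set J : Set ℝ := Ioo (-(η * r) ^ 2) 0 with hJ
  set A : ℝ≥0∞ := energyA ((0 : ℝ), x₀) r u with hA
  set ρ : ℝ≥0∞ := ENNReal.ofReal r with hρ
  have hρ0 : ρ ≠ 0 := (ENNReal.ofReal_pos.2 hr).ne'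
  have hρT : ρ ≠ ⊤ := ENNReal.ofReal_ne_top
  have hQprod : Q = I ×ˢ S := rfl
  have hηr : 0 < η * r := mul_pos hη hr
  have hJI : J ⊆ I := by
    refine Ioo_subset_Ioo ?_ le_rfl
    have h2 : η * r ≤ r := mul_le_of_le_one_left hr.le hη1
    have : (η * r) ^ 2 ≤ r ^ 2 := pow_le_pow_left₀ hηr.le h2 2
    linarith
  -- the majorant in time, supported on the window `J`
  set g : ℝ → ℝ≥0∞ := J.indicator fun t => ENNReal.ofReal (K / Real.sqrt (-t)) with hg
  have hg_meas : Measurable g := by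
    refine Measurable.indicator ?_ measurableSet_Ioo
    fun_prop
  have hg_top : ∀ t, g t ≠ ⊤ := by
    intro t
    by_cases ht : t ∈ J
    · rw [hg, indicator_of_mem ht]; exact ENNReal.ofReal_ne_top
    · rw [hg, indicator_of_notMem ht]; exact ENNReal.zero_ne_top
  set c₀ : ℝ≥0∞ := ENNReal.ofReal ((K / (η * r)) ^ 3) with hc₀
  -- Step 1: the pointwise bound, a.e. on `Q`
  have hpt : ∀ᵐ z ∂(volume.restrict Q),
      ENNReal.ofReal (m z) ^ (3 : ℕ) ≤ g z.1 * ‖u z.1 z.2‖ₑ ^ 2 + c₀ := by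
    filter_upwards [hI, ae_restrict_mem (isOpen_parCyl _ _).measurableSet] with z hz hzQ
    have ht : z.1 ∈ I := hzQ.1
    have ht0 : 0 < -z.1 := by have := ht.2; linarith
    have hs0 : 0 < Real.sqrt (-z.1) := Real.sqrt_pos.2 ht0
    have hmK : m z ≤ K / Real.sqrt (-z.1) := by
      rw [le_div_iff₀ hs0, mul_comm]; exact hz
    have hm2 : ENNReal.ofReal (m z) ^ 2 ≤ ‖u z.1 z.2‖ₑ ^ 2 := by
      rw [← ofReal_norm]
      exact pow_le_pow_left' (ENNReal.ofReal_le_ofReal (hmu z)) 2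
    by_cases hzJ : z.1 ∈ J
    · have hgz : g z.1 = ENNReal.ofReal (K / Real.sqrt (-z.1)) := by
        rw [hg, indicator_of_mem hzJ]
      have hen : ENNReal.ofReal (m z) ≤ ENNReal.ofReal (K / Real.sqrt (-z.1)) :=
        ENNReal.ofReal_le_ofReal hmK
      calc ENNReal.ofReal (m z) ^ (3 : ℕ) = ENNReal.ofReal (m z) * ENNReal.ofReal (m z) ^ 2 := by ring
        _ ≤ g z.1 * ‖u z.1 z.2‖ₑ ^ 2 := by rw [hgz]; exact mul_le_mul' hen hm2
        _ ≤ g z.1 * ‖u z.1 z.2‖ₑ ^ 2 + c₀ := le_self_add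
    · -- before the window: `z.1 ≤ -(ηr)²`, so `√(-z.1) ≥ ηr`
      have hle : z.1 ≤ -(η * r) ^ 2 := not_lt.1 fun h => hzJ ⟨h, ht.2⟩
      have hsq : η * r ≤ Real.sqrt (-z.1) := by
        rw [Real.le_sqrt hηr.le ht0.le]; linarith
      have hm' : m z ≤ K / (η * r) := hmK.trans (div_le_div_of_nonneg_left hK hηr hsq)
      calc ENNReal.ofReal (m z) ^ (3 : ℕ) = ENNReal.ofReal (m z ^ 3) := by
            rw [ENNReal.ofReal_pow (hm0 z)]
        _ ≤ c₀ := ENNReal.ofReal_le_ofReal (pow_le_pow_left₀ (hm0 z) hm' 3)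
        _ ≤ g z.1 * ‖u z.1 z.2‖ₑ ^ 2 + c₀ := le_add_self
  -- Step 2: the slices, a.e. in `t` (definition of `A`)
  have hslice : ∀ᵐ t ∂(volume.restrict I), ∫⁻ x in S, ‖u t x‖ₑ ^ 2 ≤ ρ * A := by
    have h : ∀ᵐ t ∂(volume.restrict I), ρ⁻¹ * ∫⁻ x in S, ‖u t x‖ₑ ^ 2 ≤ A :=
      ENNReal.ae_le_essSup _
    filter_upwards [h] with t ht
    calc ∫⁻ x in S, ‖u t x‖ₑ ^ 2 = ρ * (ρ⁻¹ * ∫⁻ x in S, ‖u t x‖ₑ ^ 2) := by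
          rw [← mul_assoc, ENNReal.mul_inv_cancel hρ0 hρT, one_mul]
      _ ≤ ρ * A := mul_le_mul' le_rfl ht
  -- Step 3: Tonelli on `Q = I × S`
  have hμ : volume.restrict Q = (volume.restrict I).prod (volume.restrict S) := by
    rw [hQprod]; exact (Measure.prod_restrict I S).symm
  have hF : AEMeasurable (fun z : ℝ × (EuclideanSpace ℝ (Fin 3)) => g z.1 * ‖u z.1 z.2‖ₑ ^ 2)
      (volume.restrict Q) :=
    (hg_meas.comp measurable_fst).aemeasurable.mul (hu.enorm.pow_const 2)
  have hF' : AEMeasurable (fun z : ℝ × (EuclideanSpace ℝ (Fin 3)) => g z.1 * ‖u z.1 z.2‖ₑ ^ 2)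
      ((volume.restrict I).prod (volume.restrict S)) := hμ ▸ hF
  have hmain : ∫⁻ z in Q, g z.1 * ‖u z.1 z.2‖ₑ ^ 2 ≤
      ENNReal.ofReal (2 * K * (η * r)) * (ρ * A) := by
    calc ∫⁻ z in Q, g z.1 * ‖u z.1 z.2‖ₑ ^ 2
        = ∫⁻ t in I, ∫⁻ x in S, g t * ‖u t x‖ₑ ^ 2 := by
          rw [hμ, lintegral_prod _ hF']
      _ = ∫⁻ t in I, g t * ∫⁻ x in S, ‖u t x‖ₑ ^ 2 :=
          lintegral_congr fun t => lintegral_const_mul' _ _ (hg_top t)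
      _ ≤ ∫⁻ t in I, g t * (ρ * A) :=
          lintegral_mono_ae (hslice.mono fun t ht => mul_le_mul' le_rfl ht)
      _ = (∫⁻ t in I, g t) * (ρ * A) := lintegral_mul_const _ hg_meas
      _ = (∫⁻ t in J, ENNReal.ofReal (K / Real.sqrt (-t))) * (ρ * A) := by
          rw [hg, lintegral_indicator measurableSet_Ioo,
            Measure.restrict_restrict measurableSet_Ioo, inter_eq_left.2 hJI]
      _ = ENNReal.ofReal (2 * K * (η * r)) * (ρ * A) := by
          rw [hJ, lintegral_typeI_majorant hK hηr.le]
  -- Step 4: integrate the pointwise bound and collect the constants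
  have hvol := volume_parCyl_le ((0 : ℝ), x₀) hr
  calc ∫⁻ z in Q, ENNReal.ofReal (m z) ^ (3 : ℕ)
      ≤ ∫⁻ z in Q, (g z.1 * ‖u z.1 z.2‖ₑ ^ 2 + c₀) := lintegral_mono_ae hpt
    _ = (∫⁻ z in Q, g z.1 * ‖u z.1 z.2‖ₑ ^ 2) + c₀ * volume Q := by
        rw [lintegral_add_right _ measurable_const, setLIntegral_const]
    _ ≤ ENNReal.ofReal (2 * K * (η * r)) * (ρ * A) +
        c₀ * (ENNReal.ofReal (r ^ 2) *
          (ENNReal.ofReal ((2 * r) ^ 3) * volume (ball (0 : (EuclideanSpace ℝ (Fin 3))) 1))) :=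
        add_le_add hmain (mul_le_mul' le_rfl hvol)
    _ = ENNReal.ofReal (2 * K * η) * ρ ^ 2 * A +
        ENNReal.ofReal (8 * K ^ 3 / η ^ 3) * ρ ^ 2 * volume (ball (0 : (EuclideanSpace ℝ (Fin 3))) 1) := by
        have e1 : ENNReal.ofReal (2 * K * (η * r)) * (ρ * A) =
            ENNReal.ofReal (2 * K * η) * ρ ^ 2 * A := by
          rw [show 2 * K * (η * r) = (2 * K * η) * r by ring,
            ENNReal.ofReal_mul (by positivity), hρ]
          ring
        have e2 : c₀ * (ENNReal.ofReal (r ^ 2) *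
            (ENNReal.ofReal ((2 * r) ^ 3) * volume (ball (0 : (EuclideanSpace ℝ (Fin 3))) 1))) =
            ENNReal.ofReal (8 * K ^ 3 / η ^ 3) * ρ ^ 2 * volume (ball (0 : (EuclideanSpace ℝ (Fin 3))) 1) := by
          rw [hc₀, ← mul_assoc, ← mul_assoc, ← ENNReal.ofReal_mul (by positivity),
            ← ENNReal.ofReal_mul (by positivity), hρ, ← ENNReal.ofReal_pow hr.le,
            ← ENNReal.ofReal_mul (by positivity)]
          congr 2
          field_simp
          ring
        rw [e1, e2]

/-! ### (as11) under the meridional rate and the swirl bound -/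

/-- The cubic integrand of a field with a weak spatial gradient on `Q`, split pointwise:
`∫_{Q(z,r)} |u|³ ≤ 4 ∫ |ū|³ + 4 ∫ |u_φ|³` for `Q(z, r) ⊆ Q`.
[cite: SereginSverak2009, proof of Lemma 3.5, (as8)–(as10) (arXiv pp. 9–10)] -/
theorem lintegral_cube_le_poloidal_add_swirl {u : ℝ → (EuclideanSpace ℝ (Fin 3)) → (EuclideanSpace ℝ (Fin 3))} {Q' : Set (ℝ × (EuclideanSpace ℝ (Fin 3)))}
    (hu : AEStronglyMeasurable (uncurry u) (volume.restrict Q')) :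
    ∫⁻ q in Q', ‖u q.1 q.2‖ₑ ^ (3 : ℕ) ≤
      4 * (∫⁻ q in Q', ENNReal.ofReal ‖poloidalPart (u q.1) q.2‖ ^ (3 : ℕ)) +
        4 * ∫⁻ q in Q', ‖swirlVelocity (u q.1) q.2‖ₑ ^ (3 : ℕ) := by
  have hswm : AEMeasurable (fun q : ℝ × (EuclideanSpace ℝ (Fin 3)) => ‖swirlVelocity (u q.1) q.2‖ₑ ^ (3 : ℕ))
      (volume.restrict Q') := by
    have heq : (fun q : ℝ × (EuclideanSpace ℝ (Fin 3)) => swirlVelocity (u q.1) q.2) =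
        fun q => (cylRadius q.2)⁻¹ * (q.2 0 * u q.1 q.2 1 - q.2 1 * u q.1 q.2 0) := by
      funext q; rw [swirlVelocity_eq_inv_cylRadius_mul_swirl]; rfl
    have h0 : AEMeasurable (fun q : ℝ × (EuclideanSpace ℝ (Fin 3)) => u q.1 q.2 0) (volume.restrict Q') :=
      ((EuclideanSpace.proj (0 : Fin 3)).continuous.comp_aestronglyMeasurable hu).aemeasurable
    have h1 : AEMeasurable (fun q : ℝ × (EuclideanSpace ℝ (Fin 3)) => u q.1 q.2 1) (volume.restrict Q') :=
      ((EuclideanSpace.proj (1 : Fin 3)).continuous.comp_aestronglyMeasurable hu).aemeasurable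
    have hc0 : Measurable fun q : ℝ × (EuclideanSpace ℝ (Fin 3)) => q.2 0 :=
      (EuclideanSpace.proj (0 : Fin 3)).continuous.measurable.comp measurable_snd
    have hc1 : Measurable fun q : ℝ × (EuclideanSpace ℝ (Fin 3)) => q.2 1 :=
      (EuclideanSpace.proj (1 : Fin 3)).continuous.measurable.comp measurable_snd
    have hsw : AEMeasurable (fun q : ℝ × (EuclideanSpace ℝ (Fin 3)) => swirlVelocity (u q.1) q.2) (volume.restrict Q') := by
      rw [heq]
      exact ((continuous_cylRadius.measurable.comp measurable_snd).inv.aemeasurable).mul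
        ((hc0.aemeasurable.mul h1).sub (hc1.aemeasurable.mul h0))
    exact hsw.enorm.pow_const 3
  calc ∫⁻ q in Q', ‖u q.1 q.2‖ₑ ^ (3 : ℕ)
      ≤ ∫⁻ q in Q', (4 * ENNReal.ofReal ‖poloidalPart (u q.1) q.2‖ ^ (3 : ℕ) +
          4 * ‖swirlVelocity (u q.1) q.2‖ₑ ^ (3 : ℕ)) := by
        refine lintegral_mono fun q => ?_
        rw [← mul_add]
        exact enorm_pow_three_le_poloidal_add_swirl (u q.1) q.2
    _ = 4 * (∫⁻ q in Q', ENNReal.ofReal ‖poloidalPart (u q.1) q.2‖ ^ (3 : ℕ)) +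
          4 * ∫⁻ q in Q', ‖swirlVelocity (u q.1) q.2‖ₑ ^ (3 : ℕ) := by
        rw [lintegral_add_right' _ (hswm.const_mul _), lintegral_const_mul' _ _ (by norm_num),
          lintegral_const_mul'' _ hswm]

/-- `A(z, r) ≤ 2 A(z, 2r)` for the cylinders about a common centre (`𝒞(x, r) ⊆ 𝒞(x, 2r)`, the time
intervals nested, the prefactor `r⁻¹` doubling). [cite: SereginSverak2009, §3 p. 9 (definition of A)] -/
theorem energyA_le_two_mul_energyA_double (z : ℝ × (EuclideanSpace ℝ (Fin 3))) {r : ℝ} (hr : 0 < r) (u : ℝ → (EuclideanSpace ℝ (Fin 3)) → (EuclideanSpace ℝ (Fin 3))) :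
    energyA z r u ≤ 2 * energyA z (2 * r) u := by
  have ht : Ioo (z.1 - r ^ 2) z.1 ⊆ Ioo (z.1 - (2 * r) ^ 2) z.1 :=
    Ioo_subset_Ioo (by nlinarith) le_rfl
  have hx : spaceCyl z.2 r ⊆ spaceCyl z.2 (2 * r) := by
    intro x hx
    rw [mem_spaceCyl] at hx ⊢
    exact ⟨by linarith [hx.1], by linarith [hx.2]⟩
  have h := energyA_le_of_subset (u := u) hr (by positivity : 0 < 2 * r) ht hx
  rwa [show 2 * r / r = 2 by field_simp, ENNReal.ofReal_ofNat] at h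

/-- **Seregin–Šverák 2009, proof of Lemma 3.5, (as11) with the rate on the meridional part only.**
For all numbers `C, C₂` and every `ε > 0` there is `F = f₁(ε, C, C₂)` such that for every field `u`
with a weak spatial gradient `G` on `Q = 𝒞 × ]-1, 0[` (Remark 3.4) satisfying
(1.1) `√(-t) ‖ū(t, x)‖ ≤ C` a.e. on `Q` (`ū = poloidalPart (u t)`, the meridional part
`v̄ = v_ϱ e_ϱ + v₃ e₃`) and (as7) `|Γ(t, x)| ≤ C₂` a.e. on `Q` (`Γ = swirl (u t) = |x'| u_φ`), all
`z_b = (0, b e₃)`, `|b| ≤ 1/4` and `0 < r ≤ 3/8`: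
`C(z_b, r; u) ≤ ε (E(z_b, 2r; G) + A(z_b, 2r; u)) + F`
("Adding (as8) and (as9) … Applying Young's inequality in (as10), we arrive at the important
estimate (as11) `C(z_b,r;v) ≤ ε(E(z_b,r;v) + A(z_b,r;v)) + f₁(ε, C, C₂)`"; here with the doubled
radius of the tree's Sobolev-on-balls route, the shape consumed by `decay_step_half36`). Proof:
`|u|³ ≤ 4(|ū|³ + |u_φ|³)`; the azimuthal part by `exists_lintegral_swirl_cube_le` and Young
(`mul_rpow_nine_tenths_le_eps`); the meridional part by `lintegral_cube_majorant_le_of_rate` with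
the window parameter `η = min(1, ε/(32K))`, `K = max(C, 1)`, and `A(z_b, r) ≤ 2A(z_b, 2r)`.
[cite: SereginSverak2009, proof of Lemma 3.5, (as8)–(as11) (arXiv pp. 9–10)] -/
theorem cubicC_le_eps_meridional (C C₂ : ℝ) {ε : ℝ≥0} (hε : 0 < ε) :
    ∃ F : ℝ≥0, ∀ (u : ℝ → (EuclideanSpace ℝ (Fin 3)) → (EuclideanSpace ℝ (Fin 3))) (G : ℝ → (EuclideanSpace ℝ (Fin 3)) → (EuclideanSpace ℝ (Fin 3)) →L[ℝ] (EuclideanSpace ℝ (Fin 3))),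
      HasWeakSpatialGradientOn (parCylOpens 0 1) u G →
      (∀ᵐ z ∂(volume.restrict (parCyl 0 1)),
        Real.sqrt (-z.1) * ‖poloidalPart (u z.1) z.2‖ ≤ C) →
      (∀ᵐ z ∂(volume.restrict (parCyl 0 1)), |swirl (u z.1) z.2| ≤ C₂) →
      ∀ b : ℝ, |b| ≤ 1 / 4 → ∀ r : ℝ, 0 < r → r ≤ 3 / 8 →
        cubicC ((0 : ℝ), b • eZ) r u ≤
          ε * (dissipationE ((0 : ℝ), b • eZ) (2 * r) G + energyA ((0 : ℝ), b • eZ) (2 * r) u) +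
            F := by
  obtain ⟨K₁, hK₁⟩ := exists_lintegral_swirl_cube_le
  -- the constants `K = max(C, 1)`, `δ = ε/2`, `ε₁ = ε/8`, `η = min(1, ε/(32K))`
  set K : ℝ := max C 1 with hKdef
  have hK1 : 1 ≤ K := le_max_right _ _
  have hK0 : 0 < K := by linarith
  set δ : ℝ≥0 := ε / 2 with hδ
  have hδδ : δ + δ = ε := add_halves ε
  set ε₁ : ℝ≥0 := ε / 8 with hε₁
  have hε₁0 : 0 < ε₁ := by positivity
  have h4ε₁ : 4 * ε₁ = δ := by
    apply NNReal.eq; rw [hε₁, hδ]; push_cast; ring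
  set η : ℝ := min 1 ((δ : ℝ) / (16 * K)) with hηdef
  have hδ0 : (0 : ℝ) < δ := by rw [hδ]; positivity
  have hη0 : 0 < η := lt_min one_pos (by positivity)
  have hη1 : η ≤ 1 := min_le_left _ _
  have hηε : 16 * K * η ≤ (δ : ℝ) := by
    have h1 : η ≤ (δ : ℝ) / (16 * K) := min_le_right _ _
    calc 16 * K * η ≤ 16 * K * ((δ : ℝ) / (16 * K)) := by gcongr
      _ = (δ : ℝ) := by field_simp
  set C₂' : ℝ≥0 := Real.toNNReal C₂ with hC₂'
  set L : ℝ≥0∞ := (K₁ : ℝ≥0∞) * ((C₂' : ℝ≥0∞) + 1) ^ (6 / 5 : ℝ) with hL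
  have hLt : L ≠ ⊤ :=
    ENNReal.mul_ne_top ENNReal.coe_ne_top (ENNReal.rpow_ne_top_of_nonneg (by norm_num) (by simp))
  have hε₁c : (ε₁ : ℝ≥0∞) ≠ 0 := by exact_mod_cast hε₁0.ne'
  set FS : ℝ≥0∞ := L ^ (10 : ℝ) * ((ε₁ : ℝ≥0∞)⁻¹) ^ (9 : ℝ) with hFS
  have hFSt : FS ≠ ⊤ :=
    ENNReal.mul_ne_top (ENNReal.rpow_ne_top_of_nonneg (by norm_num) hLt)
      (ENNReal.rpow_ne_top_of_nonneg (by norm_num) (ENNReal.inv_ne_top.2 hε₁c))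
  set FP : ℝ≥0∞ := ENNReal.ofReal (8 * K ^ 3 / η ^ 3) * volume (ball (0 : (EuclideanSpace ℝ (Fin 3))) 1) with hFP
  have hFPt : FP ≠ ⊤ := ENNReal.mul_ne_top ENNReal.ofReal_ne_top measure_ball_lt_top.ne
  set F : ℝ≥0∞ := 4 * FP + 4 * FS with hF
  have hFt : F ≠ ⊤ := ENNReal.add_ne_top.2
    ⟨ENNReal.mul_ne_top (by norm_num) hFPt, ENNReal.mul_ne_top (by norm_num) hFSt⟩
  refine ⟨F.toNNReal, fun u G hG hrate hsw b hb r hr hr38 => ?_⟩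
  rw [ENNReal.coe_toNNReal hFt]
  -- notation
  set z : ℝ × (EuclideanSpace ℝ (Fin 3)) := ((0 : ℝ), b • eZ) with hz
  set R : ℝ≥0∞ := ENNReal.ofReal r with hR
  have hR0 : R ≠ 0 := (ENNReal.ofReal_pos.2 hr).ne'
  have hRt : R ≠ ∞ := ENNReal.ofReal_ne_top
  have hR2 : R ^ 2 ≠ 0 := pow_ne_zero _ hR0
  have hR2t : R ^ 2 ≠ ∞ := ENNReal.pow_ne_top hRt
  set A := energyA z (2 * r) u with hA
  set E := dissipationE z (2 * r) G with hE
  set A₁ := energyA z r u with hA₁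
  -- `Q(z_b, r) ⊆ Q`
  have hsub : parCyl z r ⊆ parCyl 0 1 :=
    parCyl_axis_subset hr.le (by linarith [abs_nonneg b])
  have hum : AEStronglyMeasurable (uncurry u) (volume.restrict (parCyl z r)) :=
    (hG.locallyIntegrableOn.mono_set (by rw [coe_parCylOpens]; exact hsub)).aestronglyMeasurable
  -- the azimuthal part: (as8) and Young
  have hsw' : ∀ᵐ q ∂(volume.restrict (parCyl 0 1)), |swirl (u q.1) q.2| ≤ (C₂' : ℝ) :=
    hsw.mono fun q hq => hq.trans (Real.le_coe_toNNReal C₂)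
  have hS : (R ^ 2)⁻¹ * (∫⁻ q in parCyl z r, ‖swirlVelocity (u q.1) q.2‖ₑ ^ (3 : ℕ)) ≤
      (ε₁ : ℝ≥0∞) * (A + E) + FS :=
    (hK₁ u G C₂' b r hG hsw' hb hr hr38).trans (mul_rpow_nine_tenths_le_eps L _ hε₁0)
  -- the meridional part: (as9) on the window
  have hrate' : ∀ᵐ q ∂(volume.restrict (parCyl z r)),
      Real.sqrt (-q.1) * ‖poloidalPart (u q.1) q.2‖ ≤ K :=
    (ae_restrict_of_ae_restrict_of_subset hsub hrate).mono fun q hq => hq.trans (le_max_left _ _)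
  have hP₀ := lintegral_cube_majorant_le_of_rate hr hK0.le hum
    (m := fun q => ‖poloidalPart (u q.1) q.2‖) (fun q => norm_nonneg _)
    (fun q => norm_poloidalPart_le _ _) hrate' hη0 hη1
  have hP : (R ^ 2)⁻¹ * (∫⁻ q in parCyl z r, ENNReal.ofReal ‖poloidalPart (u q.1) q.2‖ ^ (3 : ℕ)) ≤
      ENNReal.ofReal (2 * K * η) * A₁ + FP := by
    calc (R ^ 2)⁻¹ * (∫⁻ q in parCyl z r, ENNReal.ofReal ‖poloidalPart (u q.1) q.2‖ ^ (3 : ℕ))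
        ≤ (R ^ 2)⁻¹ * (ENNReal.ofReal (2 * K * η) * R ^ 2 * A₁ +
            ENNReal.ofReal (8 * K ^ 3 / η ^ 3) * R ^ 2 * volume (ball (0 : (EuclideanSpace ℝ (Fin 3))) 1)) := by
          gcongr
      _ = ((R ^ 2)⁻¹ * R ^ 2) * (ENNReal.ofReal (2 * K * η) * A₁ + FP) := by rw [hFP]; ring
      _ = ENNReal.ofReal (2 * K * η) * A₁ + FP := by rw [ENNReal.inv_mul_cancel hR2 hR2t, one_mul]
  have hA₁ : A₁ ≤ 2 * A := energyA_le_two_mul_energyA_double z hr u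
  -- the coefficients
  have hcoefP : 4 * ENNReal.ofReal (2 * K * η) * 2 ≤ (δ : ℝ≥0∞) := by
    have e : (4 : ℝ≥0∞) * ENNReal.ofReal (2 * K * η) * 2 = ENNReal.ofReal (16 * K * η) := by
      rw [← ENNReal.ofReal_ofNat 4, ← ENNReal.ofReal_ofNat 2, ← ENNReal.ofReal_mul (by norm_num),
        ← ENNReal.ofReal_mul (by positivity)]
      congr 1; ring
    rw [e, ← ENNReal.ofReal_coe_nnreal]
    exact ENNReal.ofReal_le_ofReal hηε
  -- assembly
  calc cubicC z r u = (R ^ 2)⁻¹ * ∫⁻ q in parCyl z r, ‖u q.1 q.2‖ₑ ^ (3 : ℕ) := by rw [cubicC, hR]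
    _ ≤ (R ^ 2)⁻¹ * (4 * (∫⁻ q in parCyl z r, ENNReal.ofReal ‖poloidalPart (u q.1) q.2‖ ^ (3 : ℕ)) +
          4 * ∫⁻ q in parCyl z r, ‖swirlVelocity (u q.1) q.2‖ₑ ^ (3 : ℕ)) := by
        gcongr
        exact lintegral_cube_le_poloidal_add_swirl hum
    _ = 4 * ((R ^ 2)⁻¹ * ∫⁻ q in parCyl z r, ENNReal.ofReal ‖poloidalPart (u q.1) q.2‖ ^ (3 : ℕ)) +
          4 * ((R ^ 2)⁻¹ * ∫⁻ q in parCyl z r, ‖swirlVelocity (u q.1) q.2‖ₑ ^ (3 : ℕ)) := by ring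
    _ ≤ 4 * (ENNReal.ofReal (2 * K * η) * A₁ + FP) + 4 * ((ε₁ : ℝ≥0∞) * (A + E) + FS) := by
        gcongr
    _ ≤ 4 * (ENNReal.ofReal (2 * K * η) * (2 * A) + FP) + 4 * ((ε₁ : ℝ≥0∞) * (A + E) + FS) := by
        gcongr
    _ = (4 * ENNReal.ofReal (2 * K * η) * 2) * A + ((4 * ε₁ : ℝ≥0) : ℝ≥0∞) * (A + E) + F := by
        rw [hF]; push_cast; ring
    _ ≤ (δ : ℝ≥0∞) * (A + E) + (δ : ℝ≥0∞) * (A + E) + F := by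
        rw [h4ε₁]
        gcongr ?_ + _ + _
        exact (mul_le_mul' hcoefP le_rfl).trans (mul_le_mul' le_rfl le_self_add)
    _ = ε * (E + A) + F := by
        rw [← add_mul, ← ENNReal.coe_add, hδδ, add_comm A E]

end SereginSverak2009

end Literature.Analysis.FluidPDE
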